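import Summits.Ventures.PercRepro2.CaseOneRootsAndMark
import Summits.Ventures.PercRepro2.CaseOneRootsOnlyI

/-!
# The coincident markings: `a₃ ∈ {a₁, a₂, o, b}`
(blind cell PercRepro2, p1 g17; S5 (S5.a″) (n): the faces of the cell method that land on a
coincidence of marks)

The statement of record allows coincidences among the five marks, and the glue faces of the gadget
method land on them (a gadget edge `{a₃, m}` of weight `1` moves the mark `m` onto `a₃`). With the
statement vertex equal to a mark every case-1 form is a single BHK inequality:

* `a₃ = b`: the `A`-masses with `b ∈ C₂` vanish under `Q` and `iiExprT = P(Q, a₃ ∈ C₂) · (c₀ P(Q, A) − c₁ P(Q, A, o ∈ C₂))`,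
  the threshold condition itself (`odds_pd` / `odds_q`); for `(i)` the same bracket times `P(Q, a₃ ∉ C₁)`;
* `a₃ = o`: `iiExprT = c₀ · [P(Q, b ∈ C₂) P(Q, A) − P(Q) P(Q, b ∈ C₂, A)]` (BHK 1.4 across the clusters) and
  `iExprT = c₀ · [P(Q) P(Q, b ∈ C₁, A) − P(Q, b ∈ C₁) P(Q, A)]` (BHK 1.3 in `C₁`);
* `a₃ = a₁`: `iiExprT = c₁ · [P(Q) P(Q, b, o ∈ C₂) − P(Q, b ∈ C₂) P(Q, o ∈ C₂)]` (BHK 1.3 in `C₂`) and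
  `iExprT = c₁ · [P(Q, b ∈ C₁) P(Q, o ∈ C₂) − P(Q) P(Q, b ∈ C₁, o ∈ C₂)]` (BHK 1.4);
* `a₃ = a₂`: every `A`-mass vanishes under `Q` and both forms are `0`.

Hence `(ii)`, `(i)`, `(ii-Q)`, `(i-Q)` hold for every finite graph, every weight vector and every
marking in which `a₃` coincides with another mark (`zSplitII_of_b_eq_a3`, … sixteen theorems).
Own code; standard axioms. -/

namespace Summit.Ventures.PercRepro2

namespace CaseOne

section Empty
variable {V : Type*} {E : Type*}
variable {ends : E → Sym2 V} {a₁ a₂ a₃ : V}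

/-- `{a₁ ↔ a₃} ∩ {a₂ ↔ a₃} ∩ Q` is empty. -/
lemma conn_a1_a3_a2_empty (S : Set (Config E)) :
    S ∩ connEvent ends a₁ a₃ ∩ connEvent ends a₂ a₃ ∩ (connEvent ends a₁ a₂)ᶜ = ∅ := by
  ext ω
  simp only [Set.mem_inter_iff, Set.mem_compl_iff, mem_connEvent, Set.mem_empty_iff_false,
    iff_false]
  rintro ⟨⟨⟨_, h2⟩, h3⟩, h4⟩
  exact h4 (conn_trans h2 (conn_symm h3))

/-- `{a₂ ↔ a₃} ∩ {a₁ ↔ a₃} ∩ S ∩ Q` is empty. -/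
lemma conn_a2_a3_a1_empty (S : Set (Config E)) :
    connEvent ends a₂ a₃ ∩ connEvent ends a₁ a₃ ∩ S ∩ (connEvent ends a₁ a₂)ᶜ = ∅ := by
  ext ω
  simp only [Set.mem_inter_iff, Set.mem_compl_iff, mem_connEvent, Set.mem_empty_iff_false,
    iff_false]
  rintro ⟨⟨⟨h1, h2⟩, _⟩, h4⟩
  exact h4 (conn_trans h2 (conn_symm h1))

/-- `{a₂ ↔ a₃} ∩ {a₁ ↔ a₃} ∩ Q` is empty. -/
lemma conn_a2_a3_a1_empty' :
    connEvent ends a₂ a₃ ∩ connEvent ends a₁ a₃ ∩ (connEvent ends a₁ a₂)ᶜ = ∅ := by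
  ext ω
  simp only [Set.mem_inter_iff, Set.mem_compl_iff, mem_connEvent, Set.mem_empty_iff_false,
    iff_false]
  rintro ⟨⟨h1, h2⟩, h4⟩
  exact h4 (conn_trans h2 (conn_symm h1))

/-- `{a₁ ↔ a₃} ∩ {a₂ ↔ a₃} ∩ Q` is empty. -/
lemma conn_a1_a3_a2_empty' :
    connEvent ends a₁ a₃ ∩ connEvent ends a₂ a₃ ∩ (connEvent ends a₁ a₂)ᶜ = ∅ := by
  ext ω
  simp only [Set.mem_inter_iff, Set.mem_compl_iff, mem_connEvent, Set.mem_empty_iff_false,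
    iff_false]
  rintro ⟨⟨h1, h2⟩, h4⟩
  exact h4 (conn_trans h1 (conn_symm h2))

/-- `{a₁ ↔ a₁}` is the sure event. -/
lemma connEvent_self (ends : E → Sym2 V) (a : V) : connEvent ends a a = Set.univ := by
  ext ω; simp [conn_refl]

end Empty

section Degenerate
variable {V : Type*} {E : Type*} [Fintype E] [DecidableEq E] [Fintype V] [DecidableEq V]
  {R : Type*} [Field R] [LinearOrder R] [IsStrictOrderedRing R]
variable {ends : E → Sym2 V}

/-! ### `a₃ = b` -/

omit [Fintype V] [DecidableEq V] in
/-- `iiExprT` with `b = a₃` is `P(Q, a₃ ∈ C₂)` times the threshold condition. -/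
theorem iiExprT_nonneg_of_b_eq_a3 (p : E → R) (hp : IsProbVec p) (o a₁ a₂ a₃ : V) (c₀ c₁ : R)
    (hodds : c₁ * prob p (connEvent ends a₁ a₃ ∩ connEvent ends a₂ o ∩ (connEvent ends a₁ a₂)ᶜ) ≤
      c₀ * prob p (connEvent ends a₁ a₃ ∩ (connEvent ends a₁ a₂)ᶜ)) :
    0 ≤ iiExprT p ends o a₁ a₂ a₃ a₃ c₀ c₁ := by
  rw [iiExprT_eq, conn_a2_a3_a1_empty (ends := ends) (connEvent ends a₂ o), conn_a2_a3_a1_empty',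
    prob_empty]
  have hB := prob_nonneg hp (connEvent ends a₂ a₃ ∩ (connEvent ends a₁ a₂)ᶜ)
  have := mul_nonneg hB (sub_nonneg.2 hodds)
  linarith [this]

omit [Fintype V] [DecidableEq V] in
/-- `iExprT` with `b = a₃` is `P(Q, a₃ ∉ C₁)` times the threshold condition. -/
theorem iExprT_nonneg_of_b_eq_a3 (p : E → R) (hp : IsProbVec p) (o a₁ a₂ a₃ : V) (c₀ c₁ : R)
    (hodds : c₁ * prob p (connEvent ends a₁ a₃ ∩ connEvent ends a₂ o ∩ (connEvent ends a₁ a₂)ᶜ) ≤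
      c₀ * prob p (connEvent ends a₁ a₃ ∩ (connEvent ends a₁ a₂)ᶜ)) :
    0 ≤ iExprT p ends o a₁ a₂ a₃ a₃ c₀ c₁ := by
  rw [iExprT_eq, Set.inter_self]
  have hQ : prob p (connEvent ends a₁ a₃ ∩ (connEvent ends a₁ a₂)ᶜ) ≤
      prob p (connEvent ends a₁ a₂)ᶜ := prob_mono hp Set.inter_subset_right
  have := mul_nonneg (sub_nonneg.2 hQ) (sub_nonneg.2 hodds)
  linarith [this]

/-- **`(ii)` with `b = a₃`.** -/
theorem zSplitII_of_b_eq_a3 (p : E → R) (hp : IsProbVec p) (o a₁ a₂ a₃ : V) :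
    ZSplitII p ends o a₁ a₂ a₃ a₃ := by
  unfold ZSplitII
  rw [iiExpr_eq_iiExprT]
  exact iiExprT_nonneg_of_b_eq_a3 p hp o a₁ a₂ a₃ _ _ (odds_pd p hp ends o a₁ a₂ a₃)

/-- **`(ii-Q)` with `b = a₃`.** -/
theorem zSplitIIQ_of_b_eq_a3 (p : E → R) (hp : IsProbVec p) (o a₁ a₂ a₃ : V) :
    ZSplitIIQ p ends o a₁ a₂ a₃ a₃ :=
  iiExprT_nonneg_of_b_eq_a3 p hp o a₁ a₂ a₃ _ _ (odds_q p hp ends o a₁ a₂ a₃)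

/-- **`(i)` with `b = a₃`.** -/
theorem zSplitI_of_b_eq_a3 (p : E → R) (hp : IsProbVec p) (o a₁ a₂ a₃ : V) :
    ZSplitI p ends o a₁ a₂ a₃ a₃ := by
  unfold ZSplitI
  rw [iExpr_eq_iExprT]
  exact iExprT_nonneg_of_b_eq_a3 p hp o a₁ a₂ a₃ _ _ (odds_pd p hp ends o a₁ a₂ a₃)

/-- **`(i-Q)` with `b = a₃`.** -/
theorem zSplitIQ_of_b_eq_a3 (p : E → R) (hp : IsProbVec p) (o a₁ a₂ a₃ : V) :
    ZSplitIQ p ends o a₁ a₂ a₃ a₃ :=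
  iExprT_nonneg_of_b_eq_a3 p hp o a₁ a₂ a₃ _ _ (odds_q p hp ends o a₁ a₂ a₃)

/-! ### `a₃ = o` -/

/-- `iiExprT` with `o = a₃`: `c₀` times BHK 1.4 across the clusters. -/
theorem iiExprT_nonneg_of_o_eq_a3 (p : E → R) (hp : IsProbVec p) (a₁ a₂ a₃ b : V) (c₀ c₁ : R)
    (hc₀ : 0 ≤ c₀) : 0 ≤ iiExprT p ends a₃ a₁ a₂ a₃ b c₀ c₁ := by
  rw [iiExprT_eq, conn_a1_a3_a2_empty (ends := ends) (connEvent ends a₂ b), conn_a1_a3_a2_empty',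
    prob_empty]
  have h := bhk_cross_cluster p hp ends a₁ a₂ (isUpperSet_mem_setOf a₃) (isUpperSet_mem_setOf b)
  rw [← connEvent_eq_clusterInEvent ends a₁ a₃, ← connEvent_eq_clusterInEvent ends a₂ b] at h
  have e : connEvent ends a₁ a₃ ∩ connEvent ends a₂ b ∩ (connEvent ends a₁ a₂)ᶜ =
      connEvent ends a₂ b ∩ connEvent ends a₁ a₃ ∩ (connEvent ends a₁ a₂)ᶜ := by
    ext ω; simp only [Set.mem_inter_iff]; tauto
  rw [e] at h
  have := mul_nonneg hc₀ (sub_nonneg.2 h)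
  linarith [this]

/-- `iExprT` with `o = a₃`: `c₀` times BHK 1.3 in `C₁`. -/
theorem iExprT_nonneg_of_o_eq_a3 (p : E → R) (hp : IsProbVec p) (a₁ a₂ a₃ b : V) (c₀ c₁ : R)
    (hc₀ : 0 ≤ c₀) : 0 ≤ iExprT p ends a₃ a₁ a₂ a₃ b c₀ c₁ := by
  rw [iExprT_eq, conn_a1_a3_a2_empty (ends := ends) (connEvent ends a₁ b), conn_a1_a3_a2_empty',
    prob_empty]
  have h := bhk_same_cluster_events p hp ends a₁ a₂ (isUpperSet_mem_setOf b)
    (isUpperSet_mem_setOf a₃)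
  rw [← connEvent_eq_clusterInEvent ends a₁ b, ← connEvent_eq_clusterInEvent ends a₁ a₃] at h
  have := mul_nonneg hc₀ (sub_nonneg.2 h)
  linarith [this]

/-- **`(ii)` with `o = a₃`.** -/
theorem zSplitII_of_o_eq_a3 (p : E → R) (hp : IsProbVec p) (a₁ a₂ a₃ b : V) :
    ZSplitII p ends a₃ a₁ a₂ a₃ b := by
  unfold ZSplitII
  rw [iiExpr_eq_iiExprT]
  exact iiExprT_nonneg_of_o_eq_a3 p hp a₁ a₂ a₃ b _ _ (prob_nonneg hp _)

/-- **`(ii-Q)` with `o = a₃`.** -/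
theorem zSplitIIQ_of_o_eq_a3 (p : E → R) (hp : IsProbVec p) (a₁ a₂ a₃ b : V) :
    ZSplitIIQ p ends a₃ a₁ a₂ a₃ b :=
  iiExprT_nonneg_of_o_eq_a3 p hp a₁ a₂ a₃ b _ _ (prob_nonneg hp _)

/-- **`(i)` with `o = a₃`.** -/
theorem zSplitI_of_o_eq_a3 (p : E → R) (hp : IsProbVec p) (a₁ a₂ a₃ b : V) :
    ZSplitI p ends a₃ a₁ a₂ a₃ b := by
  unfold ZSplitI
  rw [iExpr_eq_iExprT]
  exact iExprT_nonneg_of_o_eq_a3 p hp a₁ a₂ a₃ b _ _ (prob_nonneg hp _)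

/-- **`(i-Q)` with `o = a₃`.** -/
theorem zSplitIQ_of_o_eq_a3 (p : E → R) (hp : IsProbVec p) (a₁ a₂ a₃ b : V) :
    ZSplitIQ p ends a₃ a₁ a₂ a₃ b :=
  iExprT_nonneg_of_o_eq_a3 p hp a₁ a₂ a₃ b _ _ (prob_nonneg hp _)

/-! ### `a₃ = a₁` -/

/-- `iiExprT` with `a₃ = a₁`: `c₁` times BHK 1.3 in `C₂`. -/
theorem iiExprT_nonneg_of_a1_eq_a3 (p : E → R) (hp : IsProbVec p) (o a₁ a₂ b : V) (c₀ c₁ : R)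
    (hc₁ : 0 ≤ c₁) : 0 ≤ iiExprT p ends o a₁ a₂ a₁ b c₀ c₁ := by
  rw [iiExprT_eq]
  simp only [connEvent_self, Set.inter_univ, Set.univ_inter]
  have h := bhk_same_cluster_events p hp ends a₂ a₁ (isUpperSet_mem_setOf b)
    (isUpperSet_mem_setOf o)
  rw [← connEvent_eq_clusterInEvent ends a₂ b, ← connEvent_eq_clusterInEvent ends a₂ o,
    connEvent_comm ends a₂ a₁] at h
  have := mul_nonneg hc₁ (sub_nonneg.2 h)
  linarith [this]

/-- `iExprT` with `a₃ = a₁`: `c₁` times BHK 1.4 across the clusters. -/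
theorem iExprT_nonneg_of_a1_eq_a3 (p : E → R) (hp : IsProbVec p) (o a₁ a₂ b : V) (c₀ c₁ : R)
    (hc₁ : 0 ≤ c₁) : 0 ≤ iExprT p ends o a₁ a₂ a₁ b c₀ c₁ := by
  rw [iExprT_eq]
  simp only [connEvent_self, Set.inter_univ, Set.univ_inter]
  have h := bhk_cross_cluster p hp ends a₁ a₂ (isUpperSet_mem_setOf b) (isUpperSet_mem_setOf o)
  rw [← connEvent_eq_clusterInEvent ends a₁ b, ← connEvent_eq_clusterInEvent ends a₂ o] at h
  have := mul_nonneg hc₁ (sub_nonneg.2 h)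
  linarith [this]

/-- **`(ii)` with `a₃ = a₁`.** -/
theorem zSplitII_of_a1_eq_a3 (p : E → R) (hp : IsProbVec p) (o a₁ a₂ b : V) :
    ZSplitII p ends o a₁ a₂ a₁ b := by
  unfold ZSplitII
  rw [iiExpr_eq_iiExprT]
  exact iiExprT_nonneg_of_a1_eq_a3 p hp o a₁ a₂ b _ _ (prob_nonneg hp _)

/-- **`(ii-Q)` with `a₃ = a₁`.** -/
theorem zSplitIIQ_of_a1_eq_a3 (p : E → R) (hp : IsProbVec p) (o a₁ a₂ b : V) :
    ZSplitIIQ p ends o a₁ a₂ a₁ b :=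
  iiExprT_nonneg_of_a1_eq_a3 p hp o a₁ a₂ b _ _ (prob_nonneg hp _)

/-- **`(i)` with `a₃ = a₁`.** -/
theorem zSplitI_of_a1_eq_a3 (p : E → R) (hp : IsProbVec p) (o a₁ a₂ b : V) :
    ZSplitI p ends o a₁ a₂ a₁ b := by
  unfold ZSplitI
  rw [iExpr_eq_iExprT]
  exact iExprT_nonneg_of_a1_eq_a3 p hp o a₁ a₂ b _ _ (prob_nonneg hp _)

/-- **`(i-Q)` with `a₃ = a₁`.** -/
theorem zSplitIQ_of_a1_eq_a3 (p : E → R) (hp : IsProbVec p) (o a₁ a₂ b : V) :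
    ZSplitIQ p ends o a₁ a₂ a₁ b :=
  iExprT_nonneg_of_a1_eq_a3 p hp o a₁ a₂ b _ _ (prob_nonneg hp _)

/-! ### `a₃ = a₂` -/

omit [Fintype V] [DecidableEq V] [LinearOrder R] [IsStrictOrderedRing R] in
/-- `iiExprT` with `a₃ = a₂` vanishes: every `A`-mass lies inside `{a₁ ↔ a₂} ∩ Q = ∅`. -/
theorem iiExprT_eq_zero_of_a2_eq_a3 (p : E → R) (o a₁ a₂ b : V) (c₀ c₁ : R) :
    iiExprT p ends o a₁ a₂ a₂ b c₀ c₁ = 0 := by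
  rw [iiExprT_eq]
  have e1 : connEvent ends a₂ b ∩ connEvent ends a₁ a₂ ∩ connEvent ends a₂ o ∩
      (connEvent ends a₁ a₂)ᶜ = ∅ := by
    ext ω; simp only [Set.mem_inter_iff, Set.mem_compl_iff, Set.mem_empty_iff_false, iff_false]
    tauto
  have e2 : connEvent ends a₁ a₂ ∩ connEvent ends a₂ o ∩ (connEvent ends a₁ a₂)ᶜ = ∅ := by
    ext ω; simp only [Set.mem_inter_iff, Set.mem_compl_iff, Set.mem_empty_iff_false, iff_false]
    tauto
  have e3 : connEvent ends a₂ b ∩ connEvent ends a₁ a₂ ∩ (connEvent ends a₁ a₂)ᶜ = ∅ := by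
    ext ω; simp only [Set.mem_inter_iff, Set.mem_compl_iff, Set.mem_empty_iff_false, iff_false]
    tauto
  have e4 : connEvent ends a₁ a₂ ∩ (connEvent ends a₁ a₂)ᶜ = ∅ := Set.inter_compl_self _
  rw [e1, e2, e3, e4, prob_empty]
  ring

omit [Fintype V] [DecidableEq V] [LinearOrder R] [IsStrictOrderedRing R] in
/-- `iExprT` with `a₃ = a₂` vanishes. -/
theorem iExprT_eq_zero_of_a2_eq_a3 (p : E → R) (o a₁ a₂ b : V) (c₀ c₁ : R) :
    iExprT p ends o a₁ a₂ a₂ b c₀ c₁ = 0 := by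
  rw [iExprT_eq]
  have e1 : connEvent ends a₁ b ∩ connEvent ends a₁ a₂ ∩ connEvent ends a₂ o ∩
      (connEvent ends a₁ a₂)ᶜ = ∅ := by
    ext ω; simp only [Set.mem_inter_iff, Set.mem_compl_iff, Set.mem_empty_iff_false, iff_false]
    tauto
  have e2 : connEvent ends a₁ a₂ ∩ connEvent ends a₂ o ∩ (connEvent ends a₁ a₂)ᶜ = ∅ := by
    ext ω; simp only [Set.mem_inter_iff, Set.mem_compl_iff, Set.mem_empty_iff_false, iff_false]
    tauto
  have e3 : connEvent ends a₁ b ∩ connEvent ends a₁ a₂ ∩ (connEvent ends a₁ a₂)ᶜ = ∅ := by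
    ext ω; simp only [Set.mem_inter_iff, Set.mem_compl_iff, Set.mem_empty_iff_false, iff_false]
    tauto
  have e4 : connEvent ends a₁ a₂ ∩ (connEvent ends a₁ a₂)ᶜ = ∅ := Set.inter_compl_self _
  rw [e1, e2, e3, e4, prob_empty]
  ring

omit [Fintype V] [DecidableEq V] [IsStrictOrderedRing R] in
/-- **`(ii)` with `a₃ = a₂`.** -/
theorem zSplitII_of_a2_eq_a3 (p : E → R) (o a₁ a₂ b : V) : ZSplitII p ends o a₁ a₂ a₂ b := by
  unfold ZSplitII
  rw [iiExpr_eq_iiExprT, iiExprT_eq_zero_of_a2_eq_a3]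

omit [Fintype V] [DecidableEq V] [IsStrictOrderedRing R] in
/-- **`(ii-Q)` with `a₃ = a₂`.** -/
theorem zSplitIIQ_of_a2_eq_a3 (p : E → R) (o a₁ a₂ b : V) : ZSplitIIQ p ends o a₁ a₂ a₂ b := by
  unfold ZSplitIIQ
  rw [iiExprT_eq_zero_of_a2_eq_a3]

omit [Fintype V] [DecidableEq V] [IsStrictOrderedRing R] in
/-- **`(i)` with `a₃ = a₂`.** -/
theorem zSplitI_of_a2_eq_a3 (p : E → R) (o a₁ a₂ b : V) : ZSplitI p ends o a₁ a₂ a₂ b := by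
  unfold ZSplitI
  rw [iExpr_eq_iExprT, iExprT_eq_zero_of_a2_eq_a3]

omit [Fintype V] [DecidableEq V] [IsStrictOrderedRing R] in
/-- **`(i-Q)` with `a₃ = a₂`.** -/
theorem zSplitIQ_of_a2_eq_a3 (p : E → R) (o a₁ a₂ b : V) : ZSplitIQ p ends o a₁ a₂ a₂ b := by
  unfold ZSplitIQ
  rw [iExprT_eq_zero_of_a2_eq_a3]

end Degenerate

end CaseOne

end Summit.Ventures.PercRepro2
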